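import Mathlib.Algebra.Module.CharacterModule
import Mathlib.Algebra.Module.Torsion.Basic
import Mathlib.Algebra.Module.SpanRank
import Mathlib.Topology.Instances.AddCircle.Defs
import HarnessLib

/-!
# Character modules of finite modules: annihilators of `M[I]` dualise into `I · M^∨`

Topic `Algebra/Module`; namespace `Literature.Algebra.Module`; theorems only (no new definitions,
no named fact, no `sorry`).

Finite Pontryagin/Matlis-type duality facts for the character module `M^∨ = Hom(M, ℚ/ℤ)`
(Mathlib `CharacterModule`, an `R`-module by `(r φ)(m) = φ(r m)`), as used in Hida theory to treat
the degree where control is by INVARIANTS (`H¹`: `M[I] = M^Q`) on the same footing as the degree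
where control is by COINVARIANTS (`H²`: `M/IM`) — Hida passes to Pontryagin duals of the
`p`-ordinary cohomology [cite: Hida1994AIF, §3 (proof of Thm 3.2)];
[cite: Brown1982CohomologyGroups, VI.7] for the formalism:

* `natCard_characterModule_le` — `M` finite ⇒ `M^∨` finite, with the crude bound
  `#M^∨ ≤ (#M)^{#M}` (every character lands in the `#M`-torsion of `ℚ/ℤ`, which has at most `#M`
  elements, `AddCircle.card_torsion_le_of_isSMulRegular`);
* **`mem_smul_top_of_forall_torsionBySet`** — for a finitely generated ideal `I`, a character
  vanishing on `M[I] = {m | I m = 0}` lies in `I · M^∨` (extend `φ` from `M/M[I] ↪ M^n`,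
  `m ↦ (a_i m)_i`, to `M^n` by injectivity of `ℚ/ℤ`, `CharacterModule.dual_surjective_of_injective`);
* `smul_top_le_of_smul_torsionBySet_eq_zero` — hence if `s ∈ R` kills `M[I]` then
  `s · M^∨ ⊆ I · M^∨` (the input of Cayley–Hamilton on `M^∨`);
* `natCard_quotient_smul_top_le` — `M^∨ / I·M^∨ ↪ (M[I])^∨`, so `#(M^∨/I·M^∨) ≤ (#M[I])^{#M[I]}`;
* `smul_eq_zero_of_smul_characterModule_eq_zero` — `M^∨` is faithful: if `r` kills `M^∨` it kills
  `M`;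
* `Submodule.eq_top_of_sup_smul_top_eq_top`, `spanFinrank_top_le_natCard_quotient` — the nilpotent
  Nakayama lemma `N + J M = M`, `J^L M = 0 ⇒ N = M`, and the generator bound `μ_R(M) ≤ #(M/JM)`.

## References

* H. Hida, Ann. Inst. Fourier 44 (1994), §3. [Hida1994AIF]
* K. S. Brown, *Cohomology of Groups*, GTM 87 (1982), VI.7. [Brown1982CohomologyGroups]
-/

namespace Literature.Algebra.Module

open CharacterModule

variable {R : Type} [CommRing R] {M : Type} [AddCommGroup M] [Module R M]

/-! ### Finiteness of the character module of a finite module -/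

omit [Module R M] in
/-- **`M` finite ⇒ `M^∨` finite, with `#M^∨ ≤ (#M)^{#M}`.** [folklore] -/
theorem natCard_characterModule_le [Finite M] :
    Finite (CharacterModule M) ∧ Nat.card (CharacterModule M) ≤ Nat.card M ^ Nat.card M := by
  classical
  have hpos : 0 < Nat.card M := Nat.card_pos
  set T : Set (AddCircle (1 : ℚ)) := {x | Nat.card M • x = 0} with hT
  have hreg : IsSMulRegular ℚ (Nat.card M) :=
    IsSMulRegular.of_right_eq_zero_of_smul fun _ => by simp [hpos.ne']
  have hTle := AddCircle.card_torsion_le_of_isSMulRegular (1 : ℚ) (Nat.card M) hpos.ne' hreg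
  rw [Set.encard_le_coe_iff_finite_ncard_le] at hTle
  haveI : Finite T := hTle.1.to_subtype
  have hTcard : Nat.card T ≤ Nat.card M := by
    rw [Nat.card_coe_set_eq]
    exact hTle.2
  -- `φ ↦ (m ↦ φ m) : M^∨ ↪ (M → T)`
  let ev : CharacterModule M → (M → T) := fun φ m => ⟨φ m, by
    rw [hT, Set.mem_setOf_eq, ← map_nsmul, card_nsmul_eq_zero', map_zero]⟩
  have hev : Function.Injective ev := fun φ ψ h =>
    DFunLike.ext _ _ fun m => congrArg Subtype.val (congrFun h m)
  haveI : Finite (CharacterModule M) := Finite.of_injective ev hev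
  refine ⟨inferInstance, (Nat.card_le_card_of_injective ev hev).trans ?_⟩
  rw [Nat.card_fun]
  exact Nat.pow_le_pow_left hTcard _

/-! ### Characters vanishing on `M[I]` lie in `I · M^∨` -/

/-- The map `m ↦ (a_i m)_i : M → M^n` for a finite family `a`. [folklore] -/
theorem ker_pi_lsmul_eq {n : ℕ} (a : Fin n → R) :
    LinearMap.ker (LinearMap.pi fun i => (LinearMap.lsmul R M (a i) : M →ₗ[R] M)) =
      Submodule.torsionBySet R M (Set.range a) := by
  ext m
  simp only [LinearMap.mem_ker, LinearMap.pi_apply, LinearMap.lsmul_apply,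
    Submodule.mem_torsionBySet_iff, funext_iff, Pi.zero_apply, Subtype.forall, Set.mem_range]
  exact ⟨fun h b ⟨i, hi⟩ => hi ▸ h i, fun h i => h _ ⟨i, rfl⟩⟩

/-- **A character vanishing on `M[I]`, `I = (a_1, …, a_n)`, lies in `I · M^∨`.**
[cite: Hida1994AIF, §3] -/
theorem mem_smul_top_of_forall_torsionBySet {n : ℕ} (a : Fin n → R) (φ : CharacterModule M)
    (hφ : ∀ m ∈ Submodule.torsionBySet R M (Set.range a), φ m = 0) :
    φ ∈ Ideal.span (Set.range a) • (⊤ : Submodule R (CharacterModule M)) := by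
  classical
  set g : M →ₗ[R] (Fin n → M) := LinearMap.pi fun i => (LinearMap.lsmul R M (a i) : M →ₗ[R] M)
    with hg
  have hker : LinearMap.ker g = Submodule.torsionBySet R M (Set.range a) := ker_pi_lsmul_eq a
  -- `φ` descends to `M / ker g`
  have hle : (LinearMap.ker g).toAddSubgroup ≤ φ.ker := fun m hm => by
    rw [AddMonoidHom.mem_ker]
    exact hφ m (hker ▸ hm)
  set φbar : CharacterModule (M ⧸ LinearMap.ker g) :=
    QuotientAddGroup.lift (LinearMap.ker g).toAddSubgroup φ hle with hφbar
  have hφbar_mk : ∀ m : M, φbar (Submodule.Quotient.mk m) = φ m := fun m => rfl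
  -- `M / ker g ↪ M^n`, so `φbar` extends to a character `ψ` of `M^n`
  set gbar : (M ⧸ LinearMap.ker g) →ₗ[R] (Fin n → M) := (LinearMap.ker g).liftQ g le_rfl with hgbar
  have hgbar_inj : Function.Injective gbar := by
    rw [← LinearMap.ker_eq_bot, hgbar]
    exact Submodule.ker_liftQ_eq_bot _ _ _ le_rfl
  obtain ⟨ψ, hψ⟩ := dual_surjective_of_injective gbar hgbar_inj φbar
  have hψg : ∀ m : M, φ m = ψ (g m) := fun m => by
    rw [← hφbar_mk, ← hψ]
    rfl
  -- `φ = ∑_i a_i • ψ_i`, `ψ_i = ψ ∘ single_i`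
  have hsum : φ = ∑ i, a i • dual (LinearMap.single R (fun _ : Fin n => M) i) ψ := by
    refine DFunLike.ext _ _ fun m => ?_
    rw [hψg]
    change ψ (g m) = (∑ i, a i • dual (LinearMap.single R (fun _ : Fin n => M) i) ψ : M →+ _) m
    rw [AddMonoidHom.finsetSum_apply]
    have hgm : g m = ∑ i, Pi.single i (a i • m) := by
      rw [Finset.univ_sum_single]
      rfl
    rw [hgm, map_sum]
    exact Finset.sum_congr rfl fun i _ => rfl
  rw [hsum]
  refine Submodule.sum_mem _ fun i _ => Submodule.smul_mem_smul (Ideal.subset_span ⟨i, rfl⟩)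
    Submodule.mem_top

/-- **If `s` kills `M[I]` then `s · M^∨ ⊆ I · M^∨`** (`I = (a_1, …, a_n)`): the hypothesis
`range (s·) ≤ I · M^∨` of the Cayley–Hamilton theorem on `M^∨`. [cite: Hida1994AIF, §3] -/
theorem smul_top_le_of_smul_torsionBySet_eq_zero {n : ℕ} (a : Fin n → R) (s : R)
    (hs : ∀ m ∈ Submodule.torsionBySet R M (Set.range a), s • m = 0) :
    LinearMap.range (LinearMap.lsmul R (CharacterModule M) s) ≤
      Ideal.span (Set.range a) • (⊤ : Submodule R (CharacterModule M)) := by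
  rintro _ ⟨φ, rfl⟩
  rw [LinearMap.lsmul_apply]
  refine mem_smul_top_of_forall_torsionBySet a (s • φ) fun m hm => ?_
  rw [CharacterModule.smul_apply, hs m hm, map_zero]

/-- **`M^∨ / I·M^∨` embeds in `(M[I])^∨`**: restriction to `M[I]` kills exactly `I · M^∨`
(`⊇` tautological, `⊆` by `mem_smul_top_of_forall_torsionBySet`). [folklore] -/
theorem ker_dual_subtype_torsionBySet {n : ℕ} (a : Fin n → R) :
    LinearMap.ker (dual (Submodule.torsionBySet R M (Set.range a)).subtype) =
      Ideal.span (Set.range a) • (⊤ : Submodule R (CharacterModule M)) := by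
  refine le_antisymm (fun φ hφ => mem_smul_top_of_forall_torsionBySet a φ fun m hm => ?_) ?_
  · rw [LinearMap.mem_ker] at hφ
    exact DFunLike.congr_fun hφ ⟨m, hm⟩
  · refine Submodule.smul_le.2 fun r hr φ _ => ?_
    rw [LinearMap.mem_ker]
    refine DFunLike.ext _ _ fun m => ?_
    change (r • φ) (m : M) = 0
    rw [CharacterModule.smul_apply]
    have hrm : r • (m : M) = 0 := by
      have hm := m.2
      rw [Submodule.mem_torsionBySet_iff] at hm
      -- `r ∈ span (range a)` kills `m`
      refine Submodule.span_induction (p := fun r _ => r • (m : M) = 0) (fun b hb => hm ⟨b, hb⟩)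
        (zero_smul R (m : M)) (fun x y _ _ hx hy => by rw [add_smul, hx, hy, add_zero])
        (fun c x _ hx => by rw [smul_eq_mul, mul_smul, hx, smul_zero]) hr
    rw [hrm, map_zero]

/-- Hence **`#(M^∨ / I·M^∨) ≤ (#M[I])^{#M[I]}`** for finite `M[I]`. [folklore] -/
theorem natCard_quotient_smul_top_le {n : ℕ} (a : Fin n → R)
    [Finite (Submodule.torsionBySet R M (Set.range a))] :
    Finite (CharacterModule M ⧸ Ideal.span (Set.range a) • (⊤ : Submodule R (CharacterModule M))) ∧
      Nat.card (CharacterModule M ⧸ Ideal.span (Set.range a) • (⊤ : Submodule R (CharacterModule M))) ≤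
        Nat.card (Submodule.torsionBySet R M (Set.range a)) ^
          Nat.card (Submodule.torsionBySet R M (Set.range a)) := by
  obtain ⟨hfin, hcard⟩ := natCard_characterModule_le (M := Submodule.torsionBySet R M (Set.range a))
  set f := dual (R := R) (Submodule.torsionBySet R M (Set.range a)).subtype with hf
  set fbar := (LinearMap.ker f).liftQ f le_rfl with hfbar
  have hinj : Function.Injective fbar := by
    rw [← LinearMap.ker_eq_bot, hfbar]
    exact Submodule.ker_liftQ_eq_bot _ _ _ le_rfl
  rw [← ker_dual_subtype_torsionBySet a]
  haveI := hfin
  exact ⟨Finite.of_injective fbar hinj, (Nat.card_le_card_of_injective fbar hinj).trans hcard⟩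

/-! ### Faithfulness -/

omit [Module R M] in
/-- **`M^∨` is faithful**: an endomorphism killed by every character is zero. [folklore] -/
theorem eq_zero_of_forall_character_comp {f : M →+ M} (h : ∀ φ : CharacterModule M, φ.comp f = 0) :
    f = 0 := by
  refine AddMonoidHom.ext fun m => eq_zero_of_character_apply fun φ => ?_
  have := DFunLike.congr_fun (h φ) m
  rwa [AddMonoidHom.comp_apply] at this

/-- If `r` kills `M^∨` then `r` kills `M`. [folklore] -/
theorem smul_eq_zero_of_smul_characterModule_eq_zero (r : R)
    (h : ∀ φ : CharacterModule M, r • φ = 0) (m : M) : r • m = 0 := by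
  refine eq_zero_of_character_apply fun φ => ?_
  rw [← CharacterModule.smul_apply, h φ]
  rfl

/-! ### The nilpotent Nakayama lemma and the generator bound -/

/-- **`N + J M = M` and `J^L M = 0` imply `N = M`.** [folklore] -/
theorem _root_.Submodule.eq_top_of_sup_smul_top_eq_top (J : Ideal R) (N : Submodule R M)
    (h : N ⊔ J • ⊤ = ⊤) {L : ℕ} (hL : J ^ L • (⊤ : Submodule R M) = ⊥) : N = ⊤ := by
  have key : ∀ k : ℕ, N ⊔ J ^ k • ⊤ = ⊤ := by
    intro k
    induction k with
    | zero => rw [pow_zero, Ideal.one_eq_top, Submodule.top_smul, sup_top_eq]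
    | succ k ih =>
      refine le_antisymm le_top ?_
      calc (⊤ : Submodule R M) = N ⊔ J ^ k • ⊤ := ih.symm
        _ = N ⊔ J ^ k • (N ⊔ J • ⊤) := by rw [h]
        _ = N ⊔ (J ^ k • N ⊔ J ^ k • (J • ⊤)) := by rw [Submodule.smul_sup]
        _ ≤ N ⊔ J ^ (k + 1) • ⊤ :=
          sup_le le_sup_left (sup_le (Submodule.smul_le_right.trans le_sup_left) (by
            rw [← Submodule.mul_smul, ← pow_succ]
            exact le_sup_right))
  have hLk := key L
  rwa [hL, sup_bot_eq] at hLk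

/-- **The generator bound `μ_R(M) ≤ #(M / J M)`** when `J` acts nilpotently on `M` (lift all
elements of `M/JM`; nilpotent Nakayama). [folklore] -/
theorem spanFinrank_top_le_natCard_quotient (J : Ideal R) {L : ℕ}
    (hL : J ^ L • (⊤ : Submodule R M) = ⊥) [Finite (M ⧸ (J • ⊤ : Submodule R M))] :
    (⊤ : Submodule R M).spanFinrank ≤ Nat.card (M ⧸ (J • ⊤ : Submodule R M)) := by
  classical
  set out : (M ⧸ (J • ⊤ : Submodule R M)) → M :=
    Function.surjInv (Submodule.mkQ_surjective (J • ⊤ : Submodule R M)) with hout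
  have hout' : ∀ q, (J • ⊤ : Submodule R M).mkQ (out q) = q :=
    Function.surjInv_eq (Submodule.mkQ_surjective (J • ⊤ : Submodule R M))
  set s : Set M := Set.range out with hs
  have hsup : Submodule.span R s ⊔ J • ⊤ = ⊤ := by
    refine eq_top_iff.2 fun m _ => ?_
    have hdiff : m - out ((J • ⊤ : Submodule R M).mkQ m) ∈ (J • ⊤ : Submodule R M) := by
      rw [← Submodule.Quotient.eq, ← Submodule.mkQ_apply, ← Submodule.mkQ_apply, hout']
    have heq : m = out ((J • ⊤ : Submodule R M).mkQ m) + (m - out ((J • ⊤ : Submodule R M).mkQ m)) := by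
      abel
    rw [heq]
    exact Submodule.add_mem_sup (Submodule.subset_span ⟨_, rfl⟩) hdiff
  have htop := Submodule.eq_top_of_sup_smul_top_eq_top J _ hsup hL
  calc (⊤ : Submodule R M).spanFinrank = (Submodule.span R s).spanFinrank := by rw [htop]
    _ ≤ s.ncard := Submodule.spanFinrank_span_le_ncard_of_finite (Set.finite_range out)
    _ = Nat.card s := (Nat.card_coe_set_eq s).symm
    _ ≤ Nat.card (M ⧸ (J • ⊤ : Submodule R M)) :=
        Nat.card_le_card_of_surjective _ Set.rangeFactorization_surjective

end Literature.Algebra.Module
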